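import Literature.Probability.LatticeModels.PointToSemicircuitLemma
import Literature.Probability.LatticeModels.HalfPlaneClusterSides
import Literature.Probability.Percolation.InnerBoundaryConnectivity
import Literature.Probability.Percolation.HalfAnnulusDuality
import Literature.Probability.Percolation.StripCrossing
import Literature.Probability.Percolation.WindingTypes
import HarnessLib

/-!
# The pinning domain (Georgii–Higuchi 2000, Lemma 5.2): a stopping domain from exploration

Topic `Probability/LatticeModels`. Georgii–Higuchi's pinning lemma (Lemma 5.2) applies the strong
Markov property and the point-to-semicircuit lemma (Lemma 2.3, the tree's `pointToSemicircuit`)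
to "the largest interior `Λ = Int(σ_max ∪ [u,v]) ∪ R(Int …)` among the `+∗`semicircuits `σ` of the
infinite cluster around `x`". We replace this maximal-semicircuit domain by an **exploration
domain** with the same four properties — reflection symmetric, hole-free (`FarRight`), `+` (indeed
in the infinite structure `J`) on the upper lattice boundary, and *determined from outside* — whose
construction needs no Jordan interiors:

* `pinU m ω = S⁺(ω) ∩ (π_up ∖ (Λ_m ∪ ℓ_{≥ -m}))` (`ℓ_{≥ -m} = {x₂ = 0, x₁ ≥ -m}`, the far half-axis:
  Georgii–Higuchi's "in `(Δ ∪ ℓ_left)ᶜ`" for the mirror-image situation), `pinJ m ω` = sites whose `+∗`cluster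
  in `pinU` is infinite,
  `pinK` = `J ∩ Λ_L`, `pinKsym = K ∪ R(K)`;
* `pinOut L = Λ_Lᶜ` (the outside), `pinPass` = outside or not in `Ksym`, `pinReach` = lattice-reachable from the outside through passable sites,
  `pinCrust` = impassable sites adjacent to the reachable ones, and the domain
  **`pinDom m L ω = {z : z ∉ Reach, z ∉ Crust}`** (a finite subset of `Λ_L`);
* `adj_pinDom_mem_pinCrust` — its lattice boundary lies in the crust (`⊆ Ksym`; upper part `⊆ J`);
  `pinDom_Rf_iff`, `farRight_of_not_mem_pinDom`, `not_mem_pinDom_of_mem_box`, `not_mem_pinDom_of_farAxis`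
  (the domain avoids `Λ_m` and the far half-axis, since `J` does);
* `exists_attach` — a site outside the domain `∗`-adjacent from above to a domain site is, or is
  lattice-adjacent to, an upper crust site (the witness repair for `kSet`).

The outside-determination (`pinDom ω' = pinDom ω` when `ω' = ω` off `pinDom ω`) is
`PinningDomainStopping.lean`; the probabilistic pinning lemma is `PinningLemma.lean`.

## References

* H.-O. Georgii, Y. Higuchi, J. Math. Phys. 41 (2000), Lemma 5.2 and Lemma 2.3 [GeorgiiHiguchi2000].
-/

noncomputable section

open SimpleGraph Finset
open Literature.Probability.Percolation

namespace Literature.Probability.LatticeModels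

/-! ### Definitions -/

section Defs

variable (m L : ℕ) (ω : SpinConfig (Site 2))

/-- The far half-axis `ℓ_{≥ -m} = {x₂ = 0, x₁ ≥ -m}`. [folklore] -/
def farAxis : Set (Site 2) := {z | z 1 = 0 ∧ -(m : ℤ) ≤ z 0}

/-- `U(ω) = S⁺(ω) ∩ (π_up ∖ (Λ_m ∪ ℓ_{≥ -m}))`: the `+`sites of the upper half-plane off the square and
off the far half-axis. [cite: GeorgiiHiguchi2000, Lemma 5.2 ("`+∗`connected in `(Δ ∪ ℓ_left)ᶜ`")] -/
def pinU : Set (Site 2) := spinSites 1 ω ∩ (halfPlane 0 \ (↑(box 2 m) ∪ farAxis m))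

/-- `J(ω)`: the sites whose `+∗`cluster in `U(ω)` is infinite (the infinite part of
`I^{+∗}_up ∖ (Δ ∪ ℓ_{≥ -m})`). [cite: GeorgiiHiguchi2000, Lemma 5.2 (proof: "the infinite component of `I^{+∗}_up ∖ Δ`")] -/
def pinJ : Set (Site 2) := {z | (siteCluster zdStarGraph (pinU m ω) z).Infinite}

/-- `K = J ∩ Λ_L`. [folklore] -/
def pinK : Set (Site 2) := {z | z ∈ box 2 L ∧ z ∈ pinJ m ω}

/-- `Ksym = K ∪ R(K)` (the symmetrised blocking set, GH's `σ ∪ R(σ)`). [cite: GeorgiiHiguchi2000, Lemma 2.3 (`Int σ` is `R`-invariant)] -/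
def pinKsym : Set (Site 2) := {z | z ∈ pinK m L ω ∨ Rf z ∈ pinK m L ω}

/-- The outside: the complement of `Λ_L`. [folklore] -/
def pinOut : Set (Site 2) := {z | z ∉ box 2 L}

/-- Passable sites: outside, or not blocking. [folklore] -/
def pinPass : Set (Site 2) := {z | z ∈ pinOut L ∨ z ∉ pinKsym m L ω}

/-- Sites lattice-reachable from the outside through passable sites. [folklore] -/
def pinReach : Set (Site 2) :=
  {z | ∃ y ∈ pinOut L, ∃ w : (zdGraph 2).Walk y z, ∀ v ∈ w.support, v ∈ pinPass m L ω}

/-- The crust: impassable sites adjacent to reachable ones. [folklore] -/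
def pinCrust : Set (Site 2) := {k | k ∉ pinPass m L ω ∧ ∃ y ∈ pinReach m L ω, (zdGraph 2).Adj k y}

/-- **The pinning domain**: the unreachable non-crust sites (a finite subset of `Λ_L`). [cite: GeorgiiHiguchi2000, Lemma 5.2 (the domain `Λ` of the point-to-semicircuit lemma)] -/
def pinDom : Finset (Site 2) := by
  classical exact (box 2 L).filter fun z => z ∉ pinReach m L ω ∧ z ∉ pinCrust m L ω

end Defs

variable {m L : ℕ} {ω : SpinConfig (Site 2)}

/-! ### Elementary properties -/

/-- Outside sites are reachable. [folklore] -/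
theorem mem_pinReach_of_mem_pinOut {z : Site 2} (hz : z ∈ pinOut L) : z ∈ pinReach m L ω :=
  ⟨z, hz, Walk.nil, fun v hv => by rw [Walk.support_nil, List.mem_singleton] at hv; exact Or.inl (hv ▸ hz)⟩

/-- Sites outside the box are reachable. [folklore] -/
theorem mem_pinReach_of_not_mem_box {z : Site 2} (hz : z ∉ box 2 L) : z ∈ pinReach m L ω :=
  mem_pinReach_of_mem_pinOut hz

/-- Membership in the domain. [folklore] -/
theorem mem_pinDom_iff {z : Site 2} : z ∈ pinDom m L ω ↔ z ∉ pinReach m L ω ∧ z ∉ pinCrust m L ω := by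
  classical
  unfold pinDom
  rw [mem_filter, and_iff_right_iff_imp]
  intro h; by_contra hz; exact h.1 (mem_pinReach_of_not_mem_box hz)

/-- The domain lies in the box. [folklore] -/
theorem mem_box_of_mem_pinDom {z : Site 2} (hz : z ∈ pinDom m L ω) : z ∈ box 2 L := by
  by_contra h; exact (mem_pinDom_iff.1 hz).1 (mem_pinReach_of_not_mem_box h)

/-- Reachable sites are passable. [folklore] -/
theorem mem_pinPass_of_mem_pinReach {z : Site 2} (hz : z ∈ pinReach m L ω) : z ∈ pinPass m L ω := by
  obtain ⟨y, -, w, hw⟩ := hz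
  exact hw z (Walk.end_mem_support w)

/-- Every vertex of a reaching walk is reachable. [folklore] -/
theorem mem_pinReach_of_mem_support {y z v : Site 2} (hy : y ∈ pinOut L) (w : (zdGraph 2).Walk y z)
    (hw : ∀ v ∈ w.support, v ∈ pinPass m L ω) (hv : v ∈ w.support) : v ∈ pinReach m L ω :=
  ⟨y, hy, w.takeUntil v hv, fun u hu => hw u (Walk.support_takeUntil_subset_support w hv hu)⟩

/-- A passable neighbour of a reachable site is reachable. [folklore] -/
theorem mem_pinReach_of_adj {z y : Site 2} (hz : z ∈ pinPass m L ω) (hy : y ∈ pinReach m L ω)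
    (hzy : (zdGraph 2).Adj z y) : z ∈ pinReach m L ω := by
  obtain ⟨y₀, hy₀, w, hw⟩ := hy
  refine ⟨y₀, hy₀, w.append (Walk.cons hzy.symm Walk.nil), fun v hv => ?_⟩
  rw [Walk.mem_support_append_iff, Walk.support_cons, Walk.support_nil, List.mem_cons, List.mem_singleton] at hv
  rcases hv with hv | hv | hv
  · exact hw v hv
  · exact hv ▸ hw y (Walk.end_mem_support w)
  · exact hv ▸ hz

/-- A domain site has no reachable lattice neighbour. [folklore] -/
theorem not_mem_pinReach_of_adj_pinDom {g y : Site 2} (hg : g ∈ pinDom m L ω) (hgy : (zdGraph 2).Adj g y) :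
    y ∉ pinReach m L ω := by
  intro hy
  obtain ⟨hgR, hgC⟩ := mem_pinDom_iff.1 hg
  by_cases hgP : g ∈ pinPass m L ω
  · exact hgR (mem_pinReach_of_adj hgP hy hgy)
  · exact hgC ⟨hgP, y, hy, hgy⟩

/-- **The lattice boundary of the domain lies in the crust.** [cite: GeorgiiHiguchi2000, Lemma 5.2 (proof: "`∂Λ`… `ω = +1` on `σ`")] -/
theorem adj_pinDom_mem_pinCrust {g h : Site 2} (hg : g ∈ pinDom m L ω) (hh : h ∉ pinDom m L ω)
    (hgh : (zdGraph 2).Adj g h) : h ∈ pinCrust m L ω := by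
  rw [mem_pinDom_iff, not_and_or, not_not, not_not] at hh
  rcases hh with hh | hh
  · exact absurd hh (not_mem_pinReach_of_adj_pinDom hg hgh)
  · exact hh

/-- Crust sites are not in the domain. [folklore] -/
theorem not_mem_pinDom_of_mem_pinCrust {k : Site 2} (hk : k ∈ pinCrust m L ω) : k ∉ pinDom m L ω :=
  fun h => (mem_pinDom_iff.1 h).2 hk

/-- Crust sites are blocking sites inside the box, off the far half-axis. [folklore] -/
theorem pinCrust_subset {k : Site 2} (hk : k ∈ pinCrust m L ω) : k ∈ pinKsym m L ω ∧ k ∉ pinOut L := by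
  have h := hk.1
  simp only [pinPass, Set.mem_setOf_eq, not_or, not_not] at h
  exact ⟨h.2, h.1⟩

/-- `J`-sites are `+`sites of the upper half-plane off `Λ_m`. [folklore] -/
theorem mem_pinU_of_mem_pinJ {z : Site 2} (hz : z ∈ pinJ m ω) : z ∈ pinU m ω := by
  obtain ⟨y, hy⟩ := hz.nonempty
  exact hy.1

/-- Coordinates of `J`-sites. [folklore] -/
theorem pinJ_props {z : Site 2} (hz : z ∈ pinJ m ω) : ω z = 1 ∧ 0 ≤ z 1 ∧ z ∉ box 2 m := by
  obtain ⟨h1, h2, h3⟩ := mem_pinU_of_mem_pinJ hz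
  exact ⟨h1, h2, fun h => h3 (Or.inl (Finset.mem_coe.2 h))⟩

/-- Axis sites of `J` lie strictly left of `-m`. [folklore] -/
theorem apply_zero_lt_of_mem_pinJ {z : Site 2} (hz : z ∈ pinJ m ω) (hz1 : z 1 = 0) : z 0 < -(m : ℤ) := by
  obtain ⟨-, -, h3⟩ := mem_pinU_of_mem_pinJ hz
  by_contra h
  exact h3 (Or.inr ⟨hz1, not_lt.1 h⟩)

/-- `J` is closed under `∗`-adjacent `U`-sites. [folklore] -/
theorem mem_pinJ_of_adj {z y : Site 2} (hz : z ∈ pinJ m ω) (hy : y ∈ pinU m ω) (hzy : zdStarGraph.Adj z y) :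
    y ∈ pinJ m ω := by
  have hzC : z ∈ siteCluster zdStarGraph (pinU m ω) z := (mem_siteCluster_self_iff _ _ _).2 (mem_pinU_of_mem_pinJ hz)
  have hyC : y ∈ siteCluster zdStarGraph (pinU m ω) z := mem_siteCluster_of_adj hzC hy hzy
  change (siteCluster zdStarGraph (pinU m ω) y).Infinite
  rw [siteCluster_eq_of_mem ((mem_siteCluster_self_iff _ _ _).2 hy) hyC]
  exact hz

/-- **Upper blocking sites are `J`-sites**: `Ksym ∩ {x₂ ≥ 0} ⊆ K ⊆ J`. [folklore] -/
theorem mem_pinK_of_mem_pinKsym {z : Site 2} (hz : z ∈ pinKsym m L ω) (hz1 : 0 ≤ z 1) : z ∈ pinK m L ω := by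
  rcases hz with h | h
  · exact h
  · have h1 := (pinJ_props h.2).2.1
    rw [Rf_apply_one] at h1
    have hz0 : z 1 = 0 := by omega
    rwa [Rf_eq_self_of_axis' hz0] at h
where
  /-- local restatement to avoid a forward reference -/
  Rf_eq_self_of_axis' {z : Site 2} (hz : z 1 = 0) : Rf z = z := by
    ext i; fin_cases i
    · exact Rf_apply_zero z
    · change Rf z 1 = z 1; rw [Rf_apply_one, hz]; simp

/-- **Upper crust sites are `J`-sites.** [cite: GeorgiiHiguchi2000, Lemma 5.2 (proof)] -/
theorem mem_pinJ_of_mem_pinCrust {k : Site 2} (hk : k ∈ pinCrust m L ω) (hk1 : 0 ≤ k 1) : k ∈ pinJ m ω :=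
  (mem_pinK_of_mem_pinKsym (pinCrust_subset hk).1 hk1).2

/-! ### The domain avoids `Λ_m` and the far half-axis -/

/-- Sites of `Λ_m` are not blocking. [folklore] -/
theorem not_mem_pinKsym_of_mem_box {z : Site 2} (hz : z ∈ box 2 m) : z ∉ pinKsym m L ω := by
  rintro (h | h)
  · exact (pinJ_props h.2).2.2 hz
  · exact (pinJ_props h.2).2.2 (mem_box_Rf_iff.2 hz)

/-- **The blocking set has no axis site at columns `≥ -m`** (neither has `J`). [folklore] -/
theorem far_pinKsym : ∀ z ∈ pinKsym m L ω, z 1 = 0 → z 0 < -(m : ℤ) := by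
  rintro z (hz | hz) hz1
  · exact apply_zero_lt_of_mem_pinJ hz.2 hz1
  · have h := apply_zero_lt_of_mem_pinJ hz.2 (show Rf z 1 = 0 by rw [Rf_apply_one, hz1, neg_zero])
    rwa [Rf_apply_zero] at h

/-- A passable lattice walk from a reachable site reaches. [folklore] -/
theorem mem_pinReach_of_walk {y z : Site 2} (hy : y ∈ pinReach m L ω) (w : (zdGraph 2).Walk y z)
    (hw : ∀ v ∈ w.support, v ∈ pinPass m L ω) : z ∈ pinReach m L ω := by
  obtain ⟨y₀, hy₀, w₀, hw₀⟩ := hy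
  refine ⟨y₀, hy₀, w₀.append w, fun v hv => ?_⟩
  rw [Walk.mem_support_append_iff] at hv
  rcases hv with hv | hv
  · exact hw₀ v hv
  · exact hw v hv

/-- **The far half-axis is reachable** when the blocking set has no axis site at columns `≥ -m`
(run along the axis to the outside of the box). [folklore] -/
theorem mem_pinReach_of_farAxis {z : Site 2} (hz1 : z 1 = 0) (hz0 : -(m : ℤ) ≤ z 0) : z ∈ pinReach m L ω := by
  set k : ℕ := ((L : ℤ) + 1 - z 0).toNat with hk
  have hend : (fun w : Site 2 => w + Pi.single 0 1)^[k] z ∉ box 2 L := by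
    intro h; have := (mem_box.1 h 0).2; rw [(iterate_right_apply z k).1] at this; omega
  refine ⟨_, hend, (Zhang.stepRun (Pi.single 0 1) Zhang.adj_add_unitStep.1 z k).reverse, fun v hv => ?_⟩
  rw [Walk.support_reverse, List.mem_reverse, mem_support_rightRun] at hv
  exact Or.inr fun hK => by have := far_pinKsym v hK (by rw [hv.2.2, hz1]); omega

/-- **The domain avoids the far half-axis**. [cite: GeorgiiHiguchi2000, Lemma 5.2 ("in `(Δ ∪ ℓ_left)ᶜ`")] -/
theorem not_mem_pinDom_of_farAxis {z : Site 2} (hz1 : z 1 = 0) (hz0 : -(m : ℤ) ≤ z 0) : z ∉ pinDom m L ω :=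
  fun h => (mem_pinDom_iff.1 h).1 (mem_pinReach_of_farAxis hz1 hz0)

/-- **The domain avoids `Λ_m`** (down/up to the axis inside `Λ_m`, then along it). [cite: GeorgiiHiguchi2000, Lemma 5.2 ("`Δ ∩ Int σ = ∅`")] -/
theorem not_mem_pinDom_of_mem_box {z : Site 2} (hz : z ∈ box 2 m) : z ∉ pinDom m L ω := by
  intro hzD
  apply (mem_pinDom_iff.1 hzD).1
  have hzm := mem_box.1 hz
  have hax : mkSite (z 0) 0 ∈ pinReach m L ω :=
    mem_pinReach_of_farAxis rfl (by have := (hzm 0).1; rw [mkSite_apply_zero]; exact this)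
  have hvert : ∀ {a b : Site 2} (w : (zdGraph 2).Walk a b), (∀ v ∈ w.support, v ∈ box 2 m) →
      ∀ v ∈ w.support, v ∈ pinPass m L ω := fun w hw v hv => Or.inr (not_mem_pinKsym_of_mem_box (hw v hv))
  rcases le_or_gt 0 (z 1) with h1 | h1
  · obtain ⟨k, hk⟩ : ∃ k : ℕ, z 1 = k := ⟨(z 1).toNat, by omega⟩
    have hend : (fun w : Site 2 => w - Pi.single 1 1)^[k] z = mkSite (z 0) 0 := by
      rw [iterate_sub_single_one]; ext i; fin_cases i <;> simp [hk]
    refine mem_pinReach_of_walk hax ((downRun z k).reverse.copy hend rfl) (hvert _ fun v hv => ?_)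
    rw [Walk.support_copy, Walk.support_reverse, List.mem_reverse, mem_support_downRun] at hv
    have h0 := hzm 0; have h1m := hzm 1
    exact mem_box.2 fun i => by
      fin_cases i
      · change -(m : ℤ) ≤ v 0 ∧ v 0 ≤ m; rw [hv.1]; exact h0
      · change -(m : ℤ) ≤ v 1 ∧ v 1 ≤ m; omega
  · obtain ⟨k, hk⟩ : ∃ k : ℕ, z 1 = -k := ⟨(-z 1).toNat, by omega⟩
    have hend : (fun w : Site 2 => w - Pi.single 1 1)^[k] (mkSite (z 0) 0) = z := by
      rw [iterate_sub_single_one]; ext i; fin_cases i <;> simp [hk]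
    refine mem_pinReach_of_walk hax ((downRun (mkSite (z 0) 0) k).copy rfl hend) (hvert _ fun v hv => ?_)
    rw [Walk.support_copy, mem_support_downRun, mkSite_apply_zero, mkSite_apply_one] at hv
    have h0 := hzm 0; have h1m := hzm 1
    exact mem_box.2 fun i => by
      fin_cases i
      · change -(m : ℤ) ≤ v 0 ∧ v 0 ≤ m; rw [hv.1]; exact h0
      · change -(m : ℤ) ≤ v 1 ∧ v 1 ≤ m; omega

/-- Axis sites of the domain lie strictly left of `-m`. [folklore] -/
theorem apply_zero_lt_of_mem_pinDom {z : Site 2} (hz : z ∈ pinDom m L ω) (hz1 : z 1 = 0) : z 0 < -(m : ℤ) := by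
  by_contra h; exact not_mem_pinDom_of_farAxis hz1 (by omega) hz

/-! ### Symmetry -/

/-- The outside is symmetric. [folklore] -/
theorem pinOut_Rf_iff {z : Site 2} : Rf z ∈ pinOut L ↔ z ∈ pinOut L := by
  simp only [pinOut, Set.mem_setOf_eq, mem_box_Rf_iff]

/-- The blocking set is symmetric. [folklore] -/
theorem pinKsym_Rf_iff {z : Site 2} : Rf z ∈ pinKsym m L ω ↔ z ∈ pinKsym m L ω := by
  simp only [pinKsym, Set.mem_setOf_eq, Rf_Rf, or_comm]

/-- Passability is symmetric. [folklore] -/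
theorem pinPass_Rf_iff {z : Site 2} : Rf z ∈ pinPass m L ω ↔ z ∈ pinPass m L ω := by
  simp only [pinPass, Set.mem_setOf_eq, pinOut_Rf_iff, pinKsym_Rf_iff]

/-- Reachability is symmetric. [folklore] -/
theorem Rf_mem_pinReach {z : Site 2} (hz : z ∈ pinReach m L ω) : Rf z ∈ pinReach m L ω := by
  obtain ⟨y, hy, w, hw⟩ := hz
  refine ⟨Rf y, pinOut_Rf_iff.2 hy, w.map (reflectCoord (d := 2) 1).toHom, fun v hv => ?_⟩
  obtain ⟨u, hu, rfl⟩ := (mem_support_map_iff' _ w v).1 hv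
  exact pinPass_Rf_iff.2 (hw u hu)

/-- Reachability is symmetric (iff). [folklore] -/
theorem pinReach_Rf_iff {z : Site 2} : Rf z ∈ pinReach m L ω ↔ z ∈ pinReach m L ω :=
  ⟨fun h => by simpa [Rf_Rf] using Rf_mem_pinReach h, Rf_mem_pinReach⟩

/-- The crust is symmetric. [folklore] -/
theorem pinCrust_Rf_iff {z : Site 2} : Rf z ∈ pinCrust m L ω ↔ z ∈ pinCrust m L ω := by
  have key : ∀ {z : Site 2}, z ∈ pinCrust m L ω → Rf z ∈ pinCrust m L ω := by
    rintro z ⟨hzP, y, hy, hzy⟩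
    exact ⟨fun h => hzP (pinPass_Rf_iff.1 h), Rf y, Rf_mem_pinReach hy, (reflectCoord (d := 2) 1).map_rel_iff.2 hzy⟩
  exact ⟨fun h => by simpa [Rf_Rf] using key h, key⟩

/-- **The domain is reflection symmetric.** [cite: GeorgiiHiguchi2000, Lemma 2.3 (`Λ` is `R`-invariant)] -/
theorem pinDom_Rf_iff {z : Site 2} : Rf z ∈ pinDom m L ω ↔ z ∈ pinDom m L ω := by
  rw [mem_pinDom_iff, mem_pinDom_iff, pinReach_Rf_iff, pinCrust_Rf_iff]

/-! ### Hole-freeness -/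

/-- Vertices of an up-run. [folklore] -/
theorem mem_support_upRun {z w : Site 2} {k : ℕ} :
    w ∈ (Zhang.stepRun (Pi.single 1 1) Zhang.adj_add_unitStep.2.2.1 z k).support ↔
      w 0 = z 0 ∧ z 1 ≤ w 1 ∧ w 1 ≤ z 1 + k := by
  rw [Zhang.mem_support_stepRun]
  simp only [Pi.single_eq_of_ne (show (0 : Fin 2) ≠ 1 by decide), mul_zero, add_zero, Pi.single_eq_same, mul_one]
  constructor
  · rintro ⟨j, hj, h0, h1⟩; exact ⟨h0, by omega, by omega⟩
  · rintro ⟨h0, h1, h1'⟩; exact ⟨(w 1 - z 1).toNat, by omega, h0, by omega⟩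

/-- **Sites outside a box containing `A` reach far to the right avoiding `A`.** [folklore] -/
theorem farRight_of_not_mem_box {A : Finset (Site 2)} {N : ℕ} (hA : ∀ a ∈ A, a ∈ box 2 N) {y : Site 2}
    (hy : y ∉ box 2 N) : FarRight ↑A y := by
  have hAcol : ∀ a ∈ A, a 0 < (N : ℤ) + 1 := fun a ha => by have := (mem_box.1 (hA a ha) 0).2; omega
  -- Case A: far to the right
  have caseA : ∀ {y : Site 2}, (N : ℤ) + 1 ≤ y 0 → FarRight ↑A y := fun hy0 => farRight_of_gt A hAcol hy0
  -- Case B: row outside the box: run to the right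
  have caseB : ∀ {y : Site 2}, (N : ℤ) < |y 1| → FarRight ↑A y := by
    intro y hy1
    set k : ℕ := ((N : ℤ) + 1 - y 0).toNat with hk
    have hfar : FarRight ↑A ((fun w : Site 2 => w + Pi.single 0 1)^[k] y) :=
      caseA (by rw [(iterate_right_apply y k).1]; omega)
    refine farRight_of_walk_avoiding (Zhang.stepRun (Pi.single 0 1) Zhang.adj_add_unitStep.1 y k
      |>.mapLe zdGraph_le_zdStarGraph).reverse hfar (fun v hv hvA => ?_) y (by simp)
    rw [Walk.support_reverse, List.mem_reverse, Walk.support_mapLe_eq_support, mem_support_rightRun] at hv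
    have := (mem_box.1 (hA v hvA) 1)
    rw [hv.2.2] at this; rw [lt_abs] at hy1; omega
  by_cases h1 : (N : ℤ) < |y 1|
  · exact caseB h1
  -- Case C: row inside, so the column is outside; if to the left, go up first
  have hy0 : (N : ℤ) < |y 0| := by
    by_contra h
    push Not at h h1
    rw [abs_le] at h h1
    exact hy (mem_box.2 fun i => by fin_cases i <;> assumption)
  rw [lt_abs] at hy0
  rcases hy0 with hy0 | hy0
  · exact caseA (by omega)
  · set k : ℕ := ((N : ℤ) + 1 - y 1).toNat with hk
    have hfar : FarRight ↑A ((fun w : Site 2 => w + Pi.single 1 1)^[k] y) :=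
      caseB (by rw [Zhang.iterate_add_apply]; simp; rw [lt_abs]; left; omega)
    refine farRight_of_walk_avoiding (Zhang.stepRun (Pi.single 1 1) Zhang.adj_add_unitStep.2.2.1 y k
      |>.mapLe zdGraph_le_zdStarGraph).reverse hfar (fun v hv hvA => ?_) y (by simp)
    rw [Walk.support_reverse, List.mem_reverse, Walk.support_mapLe_eq_support, mem_support_upRun] at hv
    have := (mem_box.1 (hA v hvA) 0)
    rw [hv.1] at this; omega

/-- Outside sites reach far to the right avoiding the domain. [folklore] -/
theorem farRight_pinDom_of_mem_pinOut {y : Site 2} (hy : y ∈ pinOut L) : FarRight ↑(pinDom m L ω) y :=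
  farRight_of_not_mem_box (fun _ ha => mem_box_of_mem_pinDom ha) hy

/-- **The domain is hole-free**: every site outside it reaches far to the right by a `∗`-walk
avoiding it (the hypothesis `hHF` of `pointToSemicircuit`). [cite: GeorgiiHiguchi2000, Lemma 2.3] -/
theorem farRight_of_not_mem_pinDom {z : Site 2} (hz : z ∉ pinDom m L ω) : FarRight ↑(pinDom m L ω) z := by
  rw [mem_pinDom_iff, not_and_or, not_not, not_not] at hz
  have hreach : ∀ {z : Site 2}, z ∈ pinReach m L ω → FarRight ↑(pinDom m L ω) z := by
    rintro z ⟨y, hy, w, hw⟩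
    refine farRight_of_walk_avoiding (w.mapLe zdGraph_le_zdStarGraph) (farRight_pinDom_of_mem_pinOut hy)
      (fun v hv hvD => ?_) z (by simp)
    rw [Walk.support_mapLe_eq_support] at hv
    exact (mem_pinDom_iff.1 hvD).1 (mem_pinReach_of_mem_support hy w hw hv)
  rcases hz with hz | ⟨-, y, hy, hzy⟩
  · exact hreach hz
  · exact (hreach hy).of_adj (zdGraph_le_zdStarGraph hzy) fun h =>
      (mem_pinDom_iff.1 h).1 (by
        -- a domain site adjacent to a reachable one is impossible
        exact absurd hy (not_mem_pinReach_of_adj_pinDom h hzy))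

/-! ### Attachment of outside neighbours to the upper crust -/

/-- A diagonal `∗`-step which is not a lattice step changes both coordinates. [folklore] -/
theorem coords_ne_of_starAdj_not_adj {q z : Site 2} (hqz : zdStarGraph.Adj q z) (hl : ¬ (zdGraph 2).Adj q z) :
    q 0 ≠ z 0 ∧ q 1 ≠ z 1 := by
  rw [zdStarGraph_adj_iff] at hqz
  obtain ⟨hne, h0, h1⟩ := hqz
  rw [abs_le] at h0 h1
  rw [zdGraph_two_adj_iff] at hl
  push Not at hl
  obtain ⟨hl1, hl2, hl3, hl4⟩ := hl
  constructor <;> intro h <;> omega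

/-- **Attachment**: a site `z` outside the domain, on or above the axis, `∗`-adjacent to a domain
site `q` is an upper crust site or lattice-adjacent to an upper crust site which is `∗`-adjacent to
`q` (witness repair: "`x` is `+∗`connected to `σ`"). [cite: GeorgiiHiguchi2000, Lemma 5.2 (proof)] -/
theorem exists_attach {q z : Site 2} (hq : q ∈ pinDom m L ω) (hz : z ∉ pinDom m L ω)
    (hqz : zdStarGraph.Adj q z) (hz1 : 0 ≤ z 1) :
    ∃ a ∈ pinCrust m L ω, 0 ≤ a 1 ∧ zdStarGraph.Adj q a ∧ (z = a ∨ (zdGraph 2).Adj z a) := by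
  by_cases hl : (zdGraph 2).Adj q z
  · exact ⟨z, adj_pinDom_mem_pinCrust hq hz hl, hz1, hqz, Or.inl rfl⟩
  obtain ⟨hd0, hd1⟩ := coords_ne_of_starAdj_not_adj hqz hl
  have hqz' := hqz
  rw [zdStarGraph_adj_iff] at hqz'
  obtain ⟨-, h0, h1⟩ := hqz'
  rw [abs_le] at h0 h1
  -- the corner `c = (q 0, z 1)`
  set c := mkSite (q 0) (z 1) with hc
  have hqc : (zdGraph 2).Adj q c := by
    rcases lt_or_gt_of_ne hd1 with h | h
    · exact adj_of_stepKind (.up (show c 1 = q 1 + 1 by rw [hc, mkSite_apply_one]; omega) (by rw [hc, mkSite_apply_zero]))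
    · exact adj_of_stepKind (.down (show q 1 = c 1 + 1 by rw [hc, mkSite_apply_one]; omega) (by rw [hc, mkSite_apply_zero]))
  have hzc : (zdGraph 2).Adj z c := by
    rcases lt_or_gt_of_ne hd0 with h | h
    · exact adj_of_stepKind (.left (show z 0 = c 0 + 1 by rw [hc, mkSite_apply_zero]; omega) (by rw [hc, mkSite_apply_one]))
    · exact adj_of_stepKind (.right (show c 0 = z 0 + 1 by rw [hc, mkSite_apply_zero]; omega) (by rw [hc, mkSite_apply_one]))
  have hcR : c ∉ pinReach m L ω := not_mem_pinReach_of_adj_pinDom hq hqc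
  by_cases hcC : c ∈ pinCrust m L ω
  · exact ⟨c, hcC, by simp [hc]; exact hz1, zdGraph_le_zdStarGraph hqc, Or.inr hzc⟩
  · have hcD : c ∈ pinDom m L ω := mem_pinDom_iff.2 ⟨hcR, hcC⟩
    exact ⟨z, adj_pinDom_mem_pinCrust hcD hz hzc.symm, hz1, hqz, Or.inl rfl⟩

/-- **Attachment to `J`**: in particular such a `z` is `∗`-adjacent to, or lattice-adjacent to,
a `J`-site `∗`-adjacent to `q`; if `z` itself is a `U`-site then `z ∈ J`. [cite: GeorgiiHiguchi2000, Lemma 5.2 (proof)] -/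
theorem mem_pinJ_of_adj_pinDom {q z : Site 2} (hq : q ∈ pinDom m L ω) (hz : z ∉ pinDom m L ω)
    (hqz : zdStarGraph.Adj q z) (hzU : z ∈ pinU m ω) : z ∈ pinJ m ω := by
  obtain ⟨a, ha, ha1, -, hza⟩ := exists_attach hq hz hqz hzU.2.1
  have haJ := mem_pinJ_of_mem_pinCrust ha ha1
  rcases hza with rfl | hza
  · exact haJ
  · exact mem_pinJ_of_adj haJ hzU (zdGraph_le_zdStarGraph hza.symm)

end Literature.Probability.LatticeModels
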